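import Literature.AlgebraicGeometry.HodgeTheory.CotangentSheafAffineSemilinearLift
import Literature.AlgebraicGeometry.HodgeTheory.CotangentSheafComap
import Literature.AlgebraicGeometry.Motives.AbelianVarietyCotangentBaseChange
import Mathlib.Algebra.TrivSqZeroExt.Basic
import Mathlib.LinearAlgebra.Dual.Lemmas
import HarnessLib

/-!
# The value at the origin of a `1`-form on an abelian variety: `Γ(V, Ω¹_{A/K}) → T_e^*(A) = 𝔪_e/𝔪_e²`,
# `r · db ↦ r(e) · [b − b(e)]`, and the chain rule `(u^*ω)(e) = T_e^*(u) (ω(e))` for endomorphisms `u`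

Layer `Literature/AlgebraicGeometry/HodgeTheory`, namespace `Literature.AlgebraicGeometry.Motives.AbelianVariety`.
THEOREMS ONLY (no definition, no instance, no notation, no named fact, no `sorry`).

For an abelian variety `A` over a field `K` (tree `Motives.AbelianVariety`, origin `e = origin A`, local ring
`𝒪_{A,e} = stalkOrigin A`, cotangent space `T_e^*(A) = 𝔪_e/𝔪_e² = Cotangent A` of `Motives/AbelianVarietyCotangent`) and an
AFFINE open `V ∋ e`, the **value at the origin** of a Kähler `1`-form `ω ∈ Γ(V, Ω¹_{A/K})` (`Ω¹ = Motives.cotangentSheaf A.X`)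
is the image of `ω` in the fibre `Ω¹_{A/K} ⊗ κ(e) = 𝔪_e/𝔪_e²` ([GortzWedhorn2020] (6.3.1), Prop. 6.7: the cotangent space of a
rational point; [Hartshorne1977] II.8 p. 172, II Remark 8.9.2: `Γ(V, Ω¹) = Ω_{Γ(V)/K}` is generated by the `da`).  We record it as
an additive map `ev : Γ(V, Ω¹) → 𝔪_e/𝔪_e²` characterised by `ev (r • ω) = r(e) · ev ω` and `ev (da) = [a − a(e)]`:

* §1 the point derivation `a ↦ [a − a(e)]` on `𝒪_{A,e}` (tree `dOrigin`, `evalOrigin`): Leibniz `mk_dOrigin_mul` (linear forms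
  on `𝔪_e/𝔪_e²` are point derivations, ★ `tangentFormL_mul`, and they separate points), additivity, vanishing on constants, and
  compatibility with an endomorphism `u : A → A`: `evalOrigin_stalkMapEnd` (`(u^*a)(e) = a(e)`), `mk_dOrigin_stalkMapEnd`
  (`[u^*a − (u^*a)(e)] = T_e^*(u)[a − a(e)]`), `stalkMapEnd_germ_apply`, `germ_constToPresheaf`;
* §2 **`exists_valueAtOrigin`** (existence, from the universal property of `Γ(V, Ω¹)` on an affine `V`,
  ★ `HodgeTheory.exists_semilinear_lift_of_leibniz`, applied with values in the square-zero extension `K ⊕ 𝔪_e/𝔪_e²`) and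
  **`valueAtOrigin_ext`** (uniqueness: the `da` span, ★ `span_range_dSection_eq_top`);
* §3 `valueAtOrigin_map` — compatibility with restriction to a smaller affine `V′ ∋ e`;
* §4 **`valueAtOrigin_comap`** — the CHAIN RULE at the origin: `ev′((u^*ω)|_{V′}) = T_e^*(u) (ev ω)` for the pull-back of `1`-forms
  `u^* = cotangentSheaf.comap` (★ `HodgeTheory/CotangentSheafComap`, `comap_app_dSection`) and the cotangent map
  `T_e^*(u) = cotangentMap A u` ([GortzWedhorn2020] Remark 6.3 (3));
* §5 `exists_affineOpen_mk_dOrigin_germ_eq` — every cotangent vector is `[a − a(e)]` for a section `a` on a small affine `W ∋ e`.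

All statements take the value maps `ev` as HYPOTHESES through their two characterising properties (no definition is introduced);
`exists_valueAtOrigin` provides them.  Sequel (`Motives/AbelianVarietyGlobalOneFormsMulN`): global `1`-forms on `A` are
determined by their value at `e`, hence `[n]^* ω = n · ω` ([MumfordAV1970] §4 (iv)).  Cell hodgecm-mathlib (D-0151), F-11 α1 /
J4-(iv) brick (iv-2b)(β) FILE 1 (B-p16 (g19)); HC_CM is proved only modulo the 7 printed citations until rung 0 closes — nothing
here bears on it.

## References
* [GortzWedhorn2020] U. Görtz, T. Wedhorn, *Algebraic Geometry I*, 2nd ed. (2020): (6.3.1), (6.4), Prop. 6.7 (p. 152), Remark 6.3 (3),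
  Remark 6.12 (2) (p. 155).
* [Hartshorne1977] R. Hartshorne, *Algebraic Geometry* (1977): II.8 p. 172, II Remark 8.9.2 (p. 175), II Prop. 8.11.
* [MumfordAV1970] D. Mumford, *Abelian Varieties* (1970), §4 (iii)–(iv) (p. 42–43).
-/

noncomputable section

open CategoryTheory AlgebraicGeometry Opposite TopologicalSpace

universe u

namespace Literature.AlgebraicGeometry.Motives.AbelianVariety

open Literature.AlgebraicGeometry.HodgeTheory Literature.AlgebraicGeometry.Motives

variable {K : Type u} [Field K] (A : AbelianVariety K)

/-! ## §1 The point derivation `a ↦ [a − a(e)] ∈ 𝔪_e/𝔪_e²` on sections near the origin -/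

section PointDerivation

variable {A}

/-- Leibniz for `a ↦ [a − a(e)]` on the local ring at the origin: `[ab − (ab)(e)] = a(e)·[b − b(e)] + b(e)·[a − a(e)]`
in `𝔪_e/𝔪_e²` (linear forms on `𝔪_e/𝔪_e²` are point derivations, ★ `tangentFormL_mul`, and they separate points).
[cite: GortzWedhorn2020, (6.4) and Proposition 6.7 (p. 152), Remark 6.12 (2) (p. 155)] -/
theorem mk_dOrigin_mul (a b : stalkOrigin A) :
    Cotangent.mk A (dOrigin (a * b)) =
      evalOrigin A a • Cotangent.mk A (dOrigin b) + evalOrigin A b • Cotangent.mk A (dOrigin a) := by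
  rw [← sub_eq_zero, ← Module.forall_dual_apply_eq_zero_iff K]
  intro ψ
  have h := tangentFormL_mul (L := K) ψ a b
  simp only [tangentFormL] at h
  rw [map_sub, map_add, map_smul, map_smul, h, sub_self]

/-- Additivity of `a ↦ [a − a(e)]`. [cite: GortzWedhorn2020, (6.4) and Proposition 6.7 (p. 152), Remark 6.12 (2) (p. 155)] -/
theorem mk_dOrigin_add (a b : stalkOrigin A) :
    Cotangent.mk A (dOrigin (a + b)) = Cotangent.mk A (dOrigin a) + Cotangent.mk A (dOrigin b) := by
  rw [← map_add]
  congr 1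
  ext
  simp only [coe_dOrigin, map_add, Submodule.coe_add]
  ring

/-- `[c − c(e)] = 0` for a constant `c ∈ K`. [cite: GortzWedhorn2020, (6.4) and Proposition 6.7 (p. 152), Remark 6.12 (2) (p. 155)] -/
theorem mk_dOrigin_algebraMap (c : K) : Cotangent.mk A (dOrigin (stalkOriginAlgebraMap A c)) = 0 := by
  have h : dOrigin (stalkOriginAlgebraMap A c) = 0 := by
    ext; rw [coe_dOrigin, evalOrigin_algebraMap, sub_self]; rfl
  rw [h, map_zero]

/-- On `𝔪_e`, `[x − x(e)] = [x]`. [cite: GortzWedhorn2020, (6.4) and Proposition 6.7 (p. 152), Remark 6.12 (2) (p. 155)] -/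
theorem mk_dOrigin_of_mem {x : stalkOrigin A} (hx : x ∈ IsLocalRing.maximalIdeal (stalkOrigin A)) :
    Cotangent.mk A (dOrigin x) = Cotangent.mk A ⟨x, hx⟩ := by
  congr 1
  ext; rw [coe_dOrigin, evalOrigin_eq_zero_of_mem A hx, map_zero, sub_zero]

/-- `(u^* a)(e) = a(e)`: `u^*` is a local `K`-algebra endomorphism of `𝒪_{A,e}`. [cite: GortzWedhorn2020, Remark 6.3 (3)] -/
theorem evalOrigin_stalkMapEnd (u : A ⟶ A) (a : stalkOrigin A) :
    evalOrigin A (stalkMapEnd A u a) = evalOrigin A a := by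
  have hmem : stalkMapEnd A u (a - stalkOriginAlgebraMap A (evalOrigin A a)) ∈
      IsLocalRing.maximalIdeal (stalkOrigin A) := stalkMapEnd_mem u (sub_algebraMap_evalOrigin_mem A a)
  have h0 := evalOrigin_eq_zero_of_mem A hmem
  rwa [map_sub, stalkMapEnd_algebraMap, map_sub, evalOrigin_algebraMap, sub_eq_zero] at h0

/-- `u^*` commutes with `a ↦ [a − a(e)]`: `[u^*a − (u^*a)(e)] = T_e^*(u) [a − a(e)]`.
[cite: GortzWedhorn2020, Remark 6.3 (3)] -/
theorem mk_dOrigin_stalkMapEnd (u : A ⟶ A) (a : stalkOrigin A) :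
    Cotangent.mk A (dOrigin (stalkMapEnd A u a)) = cotangentMap A u (Cotangent.mk A (dOrigin a)) := by
  rw [cotangentMap_mk]
  congr 1
  ext
  simp only [coe_dOrigin, map_sub, stalkMapEnd_algebraMap, evalOrigin_stalkMapEnd]

/-- `u^*` on germs, applied form of ★ `germ_stalkMapEnd`. [cite: GortzWedhorn2020, Remark 6.3 (3)] -/
theorem stalkMapEnd_germ_apply (u : A ⟶ A) {V : A.X.left.Opens} (heV : origin A ∈ V) (a : Γ(A.X.left, V)) :
    stalkMapEnd A u (A.X.left.presheaf.germ V (origin A) heV a) =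
      A.X.left.presheaf.germ ((Hom.toSchemeHom u) ⁻¹ᵁ V) (origin A)
        (show (Hom.toSchemeHom u).base (origin A) ∈ V by rwa [toSchemeHom_origin]) ((Hom.toSchemeHom u).app V a) := by
  rw [← CommRingCat.comp_apply, germ_stalkMapEnd u V heV, CommRingCat.comp_apply]

/-- The germ at the origin of a constant section `c|_V` is `c ∈ K ⊆ 𝒪_{A,e}` (the structure map of the local ring at a
rational point). [cite: GortzWedhorn2020, (6.4) and Proposition 6.7 (p. 152)] -/
theorem germ_constToPresheaf {V : A.X.left.Opens} (heV : origin A ∈ V) (c : K) :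
    A.X.left.presheaf.germ V (origin A) heV ((constToPresheaf A.X).app (op V) c) = stalkOriginAlgebraMap A c := by
  rw [stalkOriginAlgebraMap_apply]
  change A.X.left.presheaf.germ V (origin A) heV
      (A.X.left.presheaf.map (homOfLE le_top).op (A.X.hom.appTop ((Scheme.ΓSpecIso (.of K)).inv c))) = _
  exact TopCat.Presheaf.germ_res_apply _ _ _ _ _

end PointDerivation

/-! ## §2 Existence and uniqueness of the value-at-the-origin map on an affine neighbourhood of `e` -/

section ValueAtOrigin

variable {A} {V : A.X.left.Opens}

/-- **The value at the origin of a `1`-form.**  For an affine open `V ∋ e` of an abelian variety `A/K` there is an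
additive map `ev : Γ(V, Ω¹_{A/K}) → T_e^*(A) = 𝔪_e/𝔪_e²` with `ev(r • ω) = r(e) · ev(ω)` and `ev(da) = [a − a(e)]`
(the fibre of `Ω¹` at the rational point `e` is the cotangent space; [GortzWedhorn2020] (6.3.1), Prop. 6.7).  Obtained from
the universal property of `Γ(V, Ω¹) = Ω_{Γ(V)/K}` (★ `exists_semilinear_lift_of_leibniz`) applied to the point derivation
`a ↦ [a − a(e)]` read in the square-zero extension `K ⊕ 𝔪_e/𝔪_e²`.
[cite: GortzWedhorn2020, (6.3.1), (6.4) and Proposition 6.7 (p. 152)] [cite: Hartshorne1977, II.8 p. 172 and II Remark 8.9.2 (p. 175)] -/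
theorem exists_valueAtOrigin (hV : IsAffineOpen V) (heV : origin A ∈ V) :
    ∃ ev : Γ(cotangentSheaf A.X, V) →+ Cotangent A,
      (∀ (r : Γ(A.X.left, V)) (ω : Γ(cotangentSheaf A.X, V)),
          ev (r • ω) = evalOrigin A (A.X.left.presheaf.germ V (origin A) heV r) • ev ω) ∧
        ∀ a : Γ(A.X.left, V),
          ev (dSection A.X V a) = Cotangent.mk A (dOrigin (A.X.left.presheaf.germ V (origin A) heV a)) := by
  letI : Module Kᵐᵒᵖ (Cotangent A) := Module.compHom _ ((RingEquiv.toOpposite K).symm : Kᵐᵒᵖ ≃+* K).toRingHom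
  haveI : IsCentralScalar K (Cotangent A) := ⟨fun _ _ => rfl⟩
  -- the ring map `r ↦ r(e)` into the square-zero extension `K ⊕ T_e^*(A)`
  let γ : Γ(A.X.left, V) →+* K := (evalOrigin A).comp (A.X.left.presheaf.germ V (origin A) heV).hom
  let φ : Γ(A.X.left, V) →+* TrivSqZeroExt K (Cotangent A) := (TrivSqZeroExt.inlHom K (Cotangent A)).comp γ
  have hφ : ∀ r, φ r = TrivSqZeroExt.inl (evalOrigin A (A.X.left.presheaf.germ V (origin A) heV r)) := fun _ => rfl
  obtain ⟨ℓ, hℓs, hℓd⟩ := exists_semilinear_lift_of_leibniz φ hV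
    (fun a => TrivSqZeroExt.inr (Cotangent.mk A (dOrigin (A.X.left.presheaf.germ V (origin A) heV a))))
    (fun a b => by rw [map_add, mk_dOrigin_add, TrivSqZeroExt.inr_add])
    (fun a b => by
      rw [map_mul, mk_dOrigin_mul, hφ, hφ, TrivSqZeroExt.inl_mul_inr, TrivSqZeroExt.inl_mul_inr,
        TrivSqZeroExt.inr_add])
    (fun s => by rw [germ_constToPresheaf, mk_dOrigin_algebraMap, TrivSqZeroExt.inr_zero])
  refine ⟨(TrivSqZeroExt.sndHom K (Cotangent A)).toAddMonoidHom.comp ℓ, fun r ω => ?_, fun a => ?_⟩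
  · change (ℓ (r • ω)).snd = _ • (ℓ ω).snd
    rw [hℓs, hφ, TrivSqZeroExt.snd_mul, TrivSqZeroExt.snd_inl, TrivSqZeroExt.fst_inl, smul_zero, add_zero]
  · change (ℓ (dSection A.X V a)).snd = _
    rw [hℓd, TrivSqZeroExt.snd_inr]

/-- **Uniqueness**: an additive map `Γ(V, Ω¹) → 𝔪_e/𝔪_e²` with `ev(r • ω) = r(e) ev(ω)` is determined by its values on the
exact forms `da` (`V` affine: `Γ(V, Ω¹)` is spanned by the `da`, ★ `span_range_dSection_eq_top`).
[cite: Hartshorne1977, II Remark 8.9.2 (p. 175)] -/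
theorem valueAtOrigin_ext (hV : IsAffineOpen V) (heV : origin A ∈ V) {ev ev' : Γ(cotangentSheaf A.X, V) →+ Cotangent A}
    (hev : ∀ (r : Γ(A.X.left, V)) (ω : Γ(cotangentSheaf A.X, V)),
      ev (r • ω) = evalOrigin A (A.X.left.presheaf.germ V (origin A) heV r) • ev ω)
    (hev' : ∀ (r : Γ(A.X.left, V)) (ω : Γ(cotangentSheaf A.X, V)),
      ev' (r • ω) = evalOrigin A (A.X.left.presheaf.germ V (origin A) heV r) • ev' ω)
    (h : ∀ a : Γ(A.X.left, V), ev (dSection A.X V a) = ev' (dSection A.X V a)) : ev = ev' := by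
  ext ω
  have hω : ω ∈ Submodule.span Γ(A.X.left, V) (Set.range (dSection A.X V)) := by
    rw [span_range_dSection_eq_top A.X hV]
    exact Submodule.mem_top
  induction hω using Submodule.span_induction with
  | mem x hx =>
    obtain ⟨a, rfl⟩ := hx
    exact h a
  | zero => rw [map_zero, map_zero]
  | add x y _ _ hx hy => rw [map_add, map_add, hx, hy]
  | smul r x _ hx => rw [hev, hev', hx]

end ValueAtOrigin

/-! ## §3 Compatibility with restriction to a smaller affine neighbourhood of `e` -/

section Restrict

variable {A} {V V' : A.X.left.Opens}

/-- **Restriction compatibility**: for affine `V' ⊆ V` containing `e`, the value at the origin of `ω|_{V'}` is that of `ω`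
(both are `e`-semilinear and agree on exact forms; uniqueness ★ `valueAtOrigin_ext`).
[cite: GortzWedhorn2020, (6.3.1), (6.4) and Proposition 6.7 (p. 152)] -/
theorem valueAtOrigin_map (hV : IsAffineOpen V) (heV : origin A ∈ V) (heV' : origin A ∈ V') (i : V' ≤ V)
    {ev : Γ(cotangentSheaf A.X, V) →+ Cotangent A} {ev' : Γ(cotangentSheaf A.X, V') →+ Cotangent A}
    (hev : ∀ (r : Γ(A.X.left, V)) (ω : Γ(cotangentSheaf A.X, V)),
      ev (r • ω) = evalOrigin A (A.X.left.presheaf.germ V (origin A) heV r) • ev ω)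
    (hevd : ∀ a : Γ(A.X.left, V),
      ev (dSection A.X V a) = Cotangent.mk A (dOrigin (A.X.left.presheaf.germ V (origin A) heV a)))
    (hev' : ∀ (r : Γ(A.X.left, V')) (ω : Γ(cotangentSheaf A.X, V')),
      ev' (r • ω) = evalOrigin A (A.X.left.presheaf.germ V' (origin A) heV' r) • ev' ω)
    (hev'd : ∀ a : Γ(A.X.left, V'),
      ev' (dSection A.X V' a) = Cotangent.mk A (dOrigin (A.X.left.presheaf.germ V' (origin A) heV' a)))
    (ω : Γ(cotangentSheaf A.X, V)) :
    ev' ((cotangentSheaf A.X).presheaf.map (homOfLE i).op ω) = ev ω := by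
  have key : ev'.comp ((cotangentSheaf A.X).presheaf.map (homOfLE i).op).hom = ev := by
    refine valueAtOrigin_ext hV heV (fun r η => ?_) hev (fun a => ?_)
    · change ev' ((cotangentSheaf A.X).presheaf.map (homOfLE i).op (r • η)) =
        _ • ev' ((cotangentSheaf A.X).presheaf.map (homOfLE i).op η)
      rw [Scheme.Modules.map_smul, hev', TopCat.Presheaf.germ_res_apply]
    · change ev' ((cotangentSheaf A.X).presheaf.map (homOfLE i).op (dSection A.X V a)) = _
      rw [map_dSection, hev'd, TopCat.Presheaf.germ_res_apply, hevd]
  exact DFunLike.congr_fun key ω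

end Restrict

/-! ## §4 Naturality under an endomorphism: `(u^*ω)(e) = T_e^*(u) (ω(e))` -/

section Comap

variable {A} {V V' : A.X.left.Opens}

/-- **The value at the origin intertwines the pull-back of `1`-forms with the cotangent map**: for an endomorphism
`u : A → A` (so `u(e) = e`), affine `V ∋ e` and affine `V' ⊆ u⁻¹V` containing `e`,
`ev'((u^*ω)|_{V'}) = T_e^*(u) (ev ω)` — the chain rule at the origin ([GortzWedhorn2020] Remark 6.3 (3): functoriality of
`𝔪_x/𝔪_x²`; `u^*(da) = d(u♯a)`, ★ `comap_app_dSection`).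
[cite: GortzWedhorn2020, Remark 6.3 (3)] [cite: Hartshorne1977, II Prop. 8.11 (the first map f^*Ω_{Y/Z} → Ω_{X/Z} of the exact sequence, adjoint form)] -/
theorem valueAtOrigin_comap (u : A ⟶ A) (hV : IsAffineOpen V) (heV : origin A ∈ V) (heV' : origin A ∈ V')
    (i : V' ≤ (Hom.toSchemeHom u) ⁻¹ᵁ V)
    {ev : Γ(cotangentSheaf A.X, V) →+ Cotangent A} {ev' : Γ(cotangentSheaf A.X, V') →+ Cotangent A}
    (hev : ∀ (r : Γ(A.X.left, V)) (ω : Γ(cotangentSheaf A.X, V)),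
      ev (r • ω) = evalOrigin A (A.X.left.presheaf.germ V (origin A) heV r) • ev ω)
    (hevd : ∀ a : Γ(A.X.left, V),
      ev (dSection A.X V a) = Cotangent.mk A (dOrigin (A.X.left.presheaf.germ V (origin A) heV a)))
    (hev' : ∀ (r : Γ(A.X.left, V')) (ω : Γ(cotangentSheaf A.X, V')),
      ev' (r • ω) = evalOrigin A (A.X.left.presheaf.germ V' (origin A) heV' r) • ev' ω)
    (hev'd : ∀ a : Γ(A.X.left, V'),
      ev' (dSection A.X V' a) = Cotangent.mk A (dOrigin (A.X.left.presheaf.germ V' (origin A) heV' a)))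
    (ω : Γ(cotangentSheaf A.X, V)) :
    ev' ((cotangentSheaf A.X).presheaf.map (homOfLE i).op
        ((cotangentSheaf.comap u.hom.hom.hom).app V ω)) = cotangentMap A u (ev ω) := by
  -- both sides are additive in `ω`, `e`-semilinear, and agree on exact forms `da`
  let res : Γ(cotangentSheaf A.X, (Hom.toSchemeHom u) ⁻¹ᵁ V) →+ Γ(cotangentSheaf A.X, V') :=
    ((cotangentSheaf A.X).presheaf.map (homOfLE i).op).hom
  let cmp : Γ(cotangentSheaf A.X, V) →+ Γ(cotangentSheaf A.X, (Hom.toSchemeHom u) ⁻¹ᵁ V) :=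
    ((cotangentSheaf.comap u.hom.hom.hom).app V).hom
  have key : ev'.comp (res.comp cmp) = (cotangentMap A u).toAddMonoidHom.comp ev := by
    refine valueAtOrigin_ext hV heV (fun r η => ?_) (fun r η => ?_) (fun a => ?_)
    · change ev' (res (((cotangentSheaf.comap u.hom.hom.hom).app V) (r • η))) =
        _ • ev' (res ((cotangentSheaf.comap u.hom.hom.hom).app V η))
      rw [Scheme.Modules.Hom.app_smul]
      change ev' ((cotangentSheaf A.X).presheaf.map (homOfLE i).op
        (((Hom.toSchemeHom u).app V r) •
          (show Γ(cotangentSheaf A.X, (Hom.toSchemeHom u) ⁻¹ᵁ V) from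
            (cotangentSheaf.comap u.hom.hom.hom).app V η))) = _
      rw [Scheme.Modules.map_smul, hev', TopCat.Presheaf.germ_res_apply, ← stalkMapEnd_germ_apply,
        evalOrigin_stalkMapEnd]
    · change cotangentMap A u (ev (r • η)) = _ • cotangentMap A u (ev η)
      rw [hev, map_smul]
    · change ev' (res ((cotangentSheaf.comap u.hom.hom.hom).app V (dSection A.X V a))) =
        cotangentMap A u (ev (dSection A.X V a))
      rw [comap_app_dSection]
      change ev' ((cotangentSheaf A.X).presheaf.map (homOfLE i).op
        (dSection A.X ((Hom.toSchemeHom u) ⁻¹ᵁ V) ((Hom.toSchemeHom u).app V a))) = _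
      rw [map_dSection, hev'd, TopCat.Presheaf.germ_res_apply, ← stalkMapEnd_germ_apply, mk_dOrigin_stalkMapEnd,
        hevd]
  exact DFunLike.congr_fun key ω

end Comap

/-! ## §5 Every cotangent vector is the value of an exact form on a small affine neighbourhood of `e` -/

section Surjective

variable {A} {V : A.X.left.Opens}

/-- **Every class in `𝔪_e/𝔪_e²` is `[a − a(e)]` for a section `a` on an affine open `W ∋ e` inside any given open
`V ∋ e`** (germs at `e` are represented on small affine opens; affine opens form a basis, Mathlib
`Scheme.isBasis_affineOpens`). [cite: GortzWedhorn2020, (6.4) and Proposition 6.7 (p. 152)] -/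
theorem exists_affineOpen_mk_dOrigin_germ_eq (heV : origin A ∈ V) (m : Cotangent A) :
    ∃ (W : A.X.left.Opens) (_ : IsAffineOpen W) (heW : origin A ∈ W) (_ : W ≤ V) (a : Γ(A.X.left, W)),
      Cotangent.mk A (dOrigin (A.X.left.presheaf.germ W (origin A) heW a)) = m := by
  obtain ⟨x, rfl⟩ := Cotangent.mk_surjective (A := A) m
  obtain ⟨U, hxU, s, hs⟩ := A.X.left.presheaf.exists_germ_eq (x := origin A) (x : stalkOrigin A)
  obtain ⟨W, hW, heW, hWUV⟩ := (Opens.isBasis_iff_nbhd.mp (Scheme.isBasis_affineOpens A.X.left))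
    (show origin A ∈ U ⊓ V from ⟨hxU, heV⟩)
  refine ⟨W, hW, heW, hWUV.trans inf_le_right, A.X.left.presheaf.map (homOfLE (hWUV.trans inf_le_left)).op s, ?_⟩
  rw [TopCat.Presheaf.germ_res_apply, hs, mk_dOrigin_of_mem x.2]

end Surjective


end Literature.AlgebraicGeometry.Motives.AbelianVariety

end
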